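import Mathlib.Analysis.InnerProductSpace.Calculus
import Literature.Topology.FourManifolds.CerfGammaFourProofs
import HarnessLib

/-!
# The open strip `S × (-L, L)` of a cylinder is diffeomorphic to the whole cylinder `S × ℝ`

Necks come in two parametrisations in the tree: the `ε`-necks of the Ricci flow
(`Literature.Geometry.Riemannian.IsCenterOfEpsNeck`, `Literature/Geometry/Riemannian/Necks.lean`; Chen–Zhu 2006,
§2 p. 4: "a standard neck `Sⁿ⁻¹ × 𝕀` with `𝕀` of the length `2ε⁻¹`") are smooth embeddings of the
open strip `Literature.Riemannian.neckStrip V L = Sᵐ × (-L, L)` (an open submanifold of the cylinder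
`Sᵐ × ℝ`), whereas the surgery / connected-sum files (`NeckConnectedSum.lean`,
`NeckSeparation.lean`, `NeckCapping.lean`; Hamilton 1997, §1.1) use necks `Sᵐ × ℝ ↪ P`
parametrised by the whole line. This file provides the reparametrisation, for any open subset
`U` of a cylinder `S × ℝ` with carrier `S × (-L, L)` (so it applies verbatim to
`U = Literature.Riemannian.neckStrip V L`, with `hU := rfl`, without this file importing the Riemannian
ones):

* `Literature.cylinderStripDiffeomorph IS S hL U hU : S × ℝ ≃ₘ U`, `(θ, t) ↦ (θ, univBall 0 L t)` — the
  height is reparametrised by Mathlib's diffeomorphism `OpenPartialHomeomorph.univBall (0 : ℝ) L`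
  of `ℝ` onto the ball `(-L, L)` (`t ↦ L t / √(1 + t²)`), which fixes `0`
  (`univBall_apply_zero`) and, as shown here, preserves the sign of the height
  (`Literature.Topology.FourManifolds.univBall_zero_pos_iff`);
* `Manifold.IsSmoothEmbedding.comp_cylinderStripDiffeomorph`: a smooth embedding of the strip
  (e.g. a neck chart of an `ε`-neck) reparametrises to a smooth embedding of the whole cylinder,
  with the same range (`Literature.Topology.FourManifolds.range_comp_cylinderStripDiffeomorph`) and the same central slice
  (`Literature.Topology.FourManifolds.image_comp_cylinderStripDiffeomorph_slice`) — a neck in the sense of the surgery files.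

## References

* B.-L. Chen, X.-P. Zhu, J. Differential Geom. 74 (2006), §2, p. 4 (`ε`-necks). [ChenZhu2006]
* R. S. Hamilton, Comm. Anal. Geom. 5 (1997), §1.1 pp. 3–4, §3.2 (C2) p. 31 (necks). [Hamilton1997]
-/

open scoped Manifold ContDiff Topology
open Set Function Metric OpenPartialHomeomorph

noncomputable section

namespace Literature.Topology.FourManifolds

/-! ### The sign of Mathlib's `univBall` on the line -/

section Line

variable {L : ℝ}

/-- On the line, `univBall 0 L t = L (√(1 + t²))⁻¹ t` for `L > 0`. [folklore] -/
theorem univBall_zero_real_apply (hL : 0 < L) (t : ℝ) :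
    univBall (0 : ℝ) L t = L * ((Real.sqrt (1 + ‖t‖ ^ 2))⁻¹ * t) := by
  have h : univBall (0 : ℝ) L t = L • ((Real.sqrt (1 + ‖t‖ ^ 2))⁻¹ • t) +ᵥ (0 : ℝ) := by
    rw [univBall, dif_pos hL]
    rfl
  rw [h, smul_eq_mul, smul_eq_mul, vadd_eq_add, add_zero]

/-- `univBall 0 L` preserves the sign: `0 < univBall 0 L t ↔ 0 < t` (`L > 0`). [folklore] -/
theorem univBall_zero_pos_iff (hL : 0 < L) (t : ℝ) : 0 < univBall (0 : ℝ) L t ↔ 0 < t := by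
  have hs : 0 < (Real.sqrt (1 + ‖t‖ ^ 2))⁻¹ := inv_pos.2 (Real.sqrt_pos.2 (by positivity))
  rw [univBall_zero_real_apply hL, mul_pos_iff_of_pos_left hL, mul_pos_iff_of_pos_left hs]

/-- `univBall 0 L` maps the line into `(-L, L)` (`L > 0`). [folklore] -/
theorem univBall_zero_mem_Ioo (hL : 0 < L) (t : ℝ) : univBall (0 : ℝ) L t ∈ Ioo (-L) L := by
  have h := (univBall (0 : ℝ) L).map_source (x := t) (by rw [univBall_source]; exact mem_univ _)
  rw [univBall_target _ hL, Real.ball_eq_Ioo, zero_sub, zero_add] at h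
  exact h

/-- `(-L, L)` is the target of `univBall 0 L` (`L > 0`). [folklore] -/
theorem mem_univBall_zero_target (hL : 0 < L) {u : ℝ} (hu : u ∈ Ioo (-L) L) :
    u ∈ (univBall (0 : ℝ) L).target := by
  rw [univBall_target _ hL, Real.ball_eq_Ioo, zero_sub, zero_add]
  exact hu

end Line

/-! ### The strip of a cylinder -/

section Cylinder

variable {ES HS : Type*} [NormedAddCommGroup ES] [NormedSpace ℝ ES] [TopologicalSpace HS]
  (IS : ModelWithCorners ℝ ES HS) (S : Type*) [TopologicalSpace S] [ChartedSpace HS S]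

/-- **The cylinder is diffeomorphic to its open strip** `S × (-L, L)` (presented as any open
subset `U` of `S × ℝ` with that carrier, e.g. `Literature.Riemannian.neckStrip V L` with `hU := rfl`):
`(θ, t) ↦ (θ, univBall 0 L t)`, with inverse `(θ, u) ↦ (θ, (univBall 0 L).symm u)`, both smooth
by Mathlib's `contDiff_univBall` / `contDiffOn_univBall_symm`. [folklore] -/
def cylinderStripDiffeomorph {L : ℝ} (hL : 0 < L) (U : TopologicalSpace.Opens (S × ℝ))
    (hU : (U : Set (S × ℝ)) = univ ×ˢ Ioo (-L) L) :
    (S × ℝ) ≃ₘ⟮IS.prod 𝓘(ℝ, ℝ), IS.prod 𝓘(ℝ, ℝ)⟯ U where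
  toFun q := ⟨(q.1, univBall (0 : ℝ) L q.2),
    show (q.1, univBall (0 : ℝ) L q.2) ∈ (U : Set (S × ℝ)) from
      hU ▸ ⟨mem_univ _, univBall_zero_mem_Ioo hL q.2⟩⟩
  invFun p := ((p : S × ℝ).1, (univBall (0 : ℝ) L).symm (p : S × ℝ).2)
  left_inv q := Prod.ext rfl
    ((univBall (0 : ℝ) L).left_inv (by rw [univBall_source]; exact mem_univ _))
  right_inv p := by
    have hp : (p : S × ℝ) ∈ (U : Set (S × ℝ)) := p.2
    rw [hU] at hp
    exact Subtype.ext (Prod.ext rfl ((univBall (0 : ℝ) L).right_inv (mem_univBall_zero_target hL hp.2)))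
  contMDiff_toFun := by
    refine (ContMDiff.subtypeVal_comp_iff U _).1 ?_
    exact contMDiff_fst.prodMk
      ((contMDiff_iff_contDiff.2 contDiff_univBall).comp contMDiff_snd)
  contMDiff_invFun := by
    refine (contMDiff_fst.comp contMDiff_subtype_val).prodMk ?_
    have h : ContMDiffOn 𝓘(ℝ, ℝ) 𝓘(ℝ, ℝ) ∞ (univBall (0 : ℝ) L).symm (ball (0 : ℝ) L) :=
      contMDiffOn_iff_contDiffOn.2 contDiffOn_univBall_symm
    refine h.comp_contMDiff (contMDiff_snd.comp contMDiff_subtype_val) fun p => ?_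
    have hp : (p : S × ℝ) ∈ (U : Set (S × ℝ)) := p.2
    rw [hU] at hp
    rw [Real.ball_eq_Ioo, zero_sub, zero_add]
    exact hp.2

variable {IS S}

/-- The strip diffeomorphism acts as `(θ, t) ↦ (θ, univBall 0 L t)`. [folklore] -/
@[simp] theorem coe_cylinderStripDiffeomorph_apply {L : ℝ} (hL : 0 < L)
    (U : TopologicalSpace.Opens (S × ℝ)) (hU : (U : Set (S × ℝ)) = univ ×ˢ Ioo (-L) L)
    (q : S × ℝ) :
    ((cylinderStripDiffeomorph IS S hL U hU q : U) : S × ℝ) = (q.1, univBall (0 : ℝ) L q.2) :=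
  rfl

/-- The strip diffeomorphism preserves the central slice: `(θ, 0) ↦ (θ, 0)`. [folklore] -/
theorem coe_cylinderStripDiffeomorph_zero {L : ℝ} (hL : 0 < L)
    (U : TopologicalSpace.Opens (S × ℝ)) (hU : (U : Set (S × ℝ)) = univ ×ˢ Ioo (-L) L) (θ : S) :
    ((cylinderStripDiffeomorph IS S hL U hU (θ, 0) : U) : S × ℝ) = (θ, 0) := by
  rw [coe_cylinderStripDiffeomorph_apply, univBall_apply_zero]

/-- The strip diffeomorphism preserves the sign of the height. [folklore] -/
theorem cylinderStripDiffeomorph_snd_pos_iff {L : ℝ} (hL : 0 < L)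
    (U : TopologicalSpace.Opens (S × ℝ)) (hU : (U : Set (S × ℝ)) = univ ×ˢ Ioo (-L) L)
    (q : S × ℝ) :
    0 < ((cylinderStripDiffeomorph IS S hL U hU q : U) : S × ℝ).2 ↔ 0 < q.2 := by
  rw [coe_cylinderStripDiffeomorph_apply]
  exact univBall_zero_pos_iff hL q.2

/-- A point of the strip of height `0` comes from the central slice. [folklore] -/
theorem cylinderStripDiffeomorph_symm_of_snd_eq_zero {L : ℝ} (hL : 0 < L)
    (U : TopologicalSpace.Opens (S × ℝ)) (hU : (U : Set (S × ℝ)) = univ ×ˢ Ioo (-L) L)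
    {p : U} (hp : (p : S × ℝ).2 = 0) :
    (cylinderStripDiffeomorph IS S hL U hU).symm p = ((p : S × ℝ).1, 0) := by
  change (((p : S × ℝ).1, (univBall (0 : ℝ) L).symm (p : S × ℝ).2) : S × ℝ) = _
  rw [hp, univBall_symm_apply_center]

variable {EP HP : Type*} [NormedAddCommGroup EP] [NormedSpace ℝ EP] [TopologicalSpace HP]
  {IP : ModelWithCorners ℝ EP HP} {P : Type*} [TopologicalSpace P] [ChartedSpace HP P]

/-- **A smooth embedding of the strip reparametrises to a smooth embedding of the cylinder**
(e.g. the neck chart of an `ε`-neck, Chen–Zhu 2006 §2 p. 4, becomes a neck `S × ℝ ↪ P` in the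
sense of `NeckConnectedSum.lean` / `NeckCapping.lean`). [folklore] -/
theorem _root_.Manifold.IsSmoothEmbedding.comp_cylinderStripDiffeomorph [IsManifold IS ∞ S]
    {L : ℝ} (hL : 0 < L) {U : TopologicalSpace.Opens (S × ℝ)}
    (hU : (U : Set (S × ℝ)) = univ ×ˢ Ioo (-L) L) {ψ : U → P}
    (hψ : Manifold.IsSmoothEmbedding (IS.prod 𝓘(ℝ, ℝ)) IP ∞ ψ) :
    Manifold.IsSmoothEmbedding (IS.prod 𝓘(ℝ, ℝ)) IP ∞
      (ψ ∘ cylinderStripDiffeomorph IS S hL U hU) :=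
  hψ.comp_diffeomorph _

omit [TopologicalSpace P] [ChartedSpace HP P] in
/-- The reparametrised embedding has the same range. [folklore] -/
theorem range_comp_cylinderStripDiffeomorph {L : ℝ} (hL : 0 < L)
    {U : TopologicalSpace.Opens (S × ℝ)} (hU : (U : Set (S × ℝ)) = univ ×ˢ Ioo (-L) L)
    (ψ : U → P) : range (ψ ∘ cylinderStripDiffeomorph IS S hL U hU) = range ψ :=
  (cylinderStripDiffeomorph IS S hL U hU).surjective.range_comp ψ

omit [TopologicalSpace P] [ChartedSpace HP P] in
/-- The reparametrised embedding has the same central slice: the images of `S × {0}` agree.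
[folklore] -/
theorem image_comp_cylinderStripDiffeomorph_slice {L : ℝ} (hL : 0 < L)
    {U : TopologicalSpace.Opens (S × ℝ)} (hU : (U : Set (S × ℝ)) = univ ×ˢ Ioo (-L) L)
    (ψ : U → P) :
    (ψ ∘ cylinderStripDiffeomorph IS S hL U hU) '' (univ ×ˢ {(0 : ℝ)}) =
      ψ '' {p | (p : S × ℝ).2 = 0} := by
  apply Subset.antisymm
  · rintro _ ⟨⟨θ, t⟩, ⟨-, ht⟩, rfl⟩
    rw [mem_singleton_iff] at ht
    subst ht
    refine ⟨_, ?_, rfl⟩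
    change ((cylinderStripDiffeomorph IS S hL U hU (θ, 0) : U) : S × ℝ).2 = 0
    rw [coe_cylinderStripDiffeomorph_zero]
  · rintro _ ⟨p, hp, rfl⟩
    refine ⟨((p : S × ℝ).1, 0), ⟨mem_univ _, rfl⟩, ?_⟩
    change ψ (cylinderStripDiffeomorph IS S hL U hU ((p : S × ℝ).1, 0)) = ψ p
    congr 1
    rw [← cylinderStripDiffeomorph_symm_of_snd_eq_zero (IS := IS) hL U hU hp,
      Diffeomorph.apply_symm_apply]

end Cylinder

end Literature.Topology.FourManifolds
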